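import Literature.IUT.LogThetaLattice.HolomorphicHull

/-!
# [IUTchIII] Remark 3.9.5 (iv), the hull case `P ∈ Hul` — proof companion

Proof-only companion (abc-iut cell, wave-3 discharge seat abc-iut-L6-d1; node **IUTchIII:Rmk3.9.5(iv)**) of
abc-iut-L6-t4's `Literature/IUT/LogThetaLattice/HolomorphicHull.lean` (p404101). That file records the
sentence of [IUTchIII] Remark 3.9.5 (iv), kurims p. 129 — "if `P ∈ Hul`, then `{φ(P)} = Φ(P) = Ξ(P)`, so
`P = φ(P) = H_Φ(P) = H_Ξ(P)`" — as the named statement `Remark395iv_hullCase Hul φ μlog`, a predicate on an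
ABSTRACT hull system `(Hul, φ, μlog)`; as its docstring says, the sentence "uses that distinct nested hulls
have distinct log-volumes", which is not part of the parameters, so the predicate does not hold for
arbitrary data. Here it is PROVED under exactly the printed inputs: (P1) `φ(H) = H` for `H ∈ Hul`
(Remark 3.9.5 (ii)) and the log-volume separation of nested hulls (a sub-hull `H ⊆ H'` with
`μ^{log}(H') ≤ μ^{log}(H)` equals `H'` — for genuine hulls `λ·𝒪 ⊆ λ'·𝒪` this is the strict monotonicity of the
`p`-adic log-volume, [IUTchIII] Prop 3.9 (i)–(iii)). No new definitions.

S. Mochizuki, *Inter-universal Teichmüller theory III*, kurims manuscript (May 2020), Remark 3.9.5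
(ii)–(iv) pp. 127–129. Claim key `Mochizuki2012`, status DISPUTED (D-0012): elementary order-theoretic
bookkeeping; nothing here asserts a disputed claim or takes a side on Cor. 3.12.
-/

namespace Literature.IUT.LogThetaLattice

universe u

variable {X : Type u} {Hul : Set (Set X)} {φ : Set X → Set X} {μlog : Set X → ℝ}

/-- **IUTchIII:Rmk3.9.5(iv)** (kurims p. 129) "if `P ∈ Hul`, then `{φ(P)} = Φ(P) = Ξ(P)`": PROVED from (P1)
`φ(H) = H` on `Hul` and the separation of nested hulls by log-volume ("distinct nested hulls have distinct
log-volumes"): the statement file's named predicate `Remark395iv_hullCase` holds.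
[claim: Mochizuki2012, status: disputed] -/
theorem remark395iv_hullCase_of_separating (hP1 : ∀ H ∈ Hul, φ H = H)
    (hsep : ∀ H ∈ Hul, ∀ H' ∈ Hul, H ⊆ H' → μlog H' ≤ μlog H → H = H') :
    Remark395iv_hullCase Hul φ μlog := by
  intro P hP
  have hφP : φ P = P := hP1 P hP
  refine ⟨Set.ext fun H => ⟨fun ⟨hH, hsub, hle⟩ => ?_, fun hH => ?_⟩,
    Set.ext fun H => ⟨fun ⟨hH, hsub, heq⟩ => ?_, fun hH => ?_⟩⟩
  · rw [Set.mem_singleton_iff, hφP]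
    exact hsep H hH P hP (hφP ▸ hsub) hle
  · rw [Set.mem_singleton_iff] at hH
    subst hH
    exact ⟨by rw [hφP]; exact hP, subset_rfl, by rw [hφP]⟩
  · rw [Set.mem_singleton_iff, hφP]
    exact hsep H hH P hP (hφP ▸ hsub) heq.ge
  · rw [Set.mem_singleton_iff] at hH
    subst hH
    exact ⟨by rw [hφP]; exact hP, subset_rfl, by rw [hφP]⟩

/-- **IUTchIII:Rmk3.9.5(iv)** (kurims p. 129) "… so `P = φ(P) = H_Φ(P) = H_Ξ(P)`": under the same inputs,
for `P ∈ Hul` all four sets coincide. [claim: Mochizuki2012, status: disputed] -/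
theorem hull_eq_hPhi_eq_hXi_of_separating (hP1 : ∀ H ∈ Hul, φ H = H)
    (hsep : ∀ H ∈ Hul, ∀ H' ∈ Hul, H ⊆ H' → μlog H' ≤ μlog H → H = H') {P : Set X} (hP : P ∈ Hul) :
    φ P = P ∧ HPhi Hul φ μlog P = P ∧ HXi Hul φ μlog P = P := by
  obtain ⟨hΦ, hΞ⟩ := remark395iv_hullCase_of_separating hP1 hsep P hP
  have hφP : φ P = P := hP1 P hP
  refine ⟨hφP, ?_, ?_⟩
  · rw [HPhi, hΦ, Set.sUnion_singleton, hφP]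
  · rw [HXi, hΞ, Set.sUnion_singleton, hφP]

/-- The separation hypothesis in its printed form: "distinct nested hulls have distinct log-volumes"
(strict monotonicity of `μ^{log}` along proper inclusions in `Hul`) implies the form used above.
[claim: Mochizuki2012, status: disputed] -/
theorem separating_of_strictMono
    (hstrict : ∀ H ∈ Hul, ∀ H' ∈ Hul, H ⊆ H' → H ≠ H' → μlog H < μlog H') :
    ∀ H ∈ Hul, ∀ H' ∈ Hul, H ⊆ H' → μlog H' ≤ μlog H → H = H' := by
  intro H hH H' hH' hsub hle
  by_contra hne
  exact absurd (hstrict H hH H' hH' hsub hne) (not_lt.mpr hle)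

end Literature.IUT.LogThetaLattice
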